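import Literature.Geometry.Kaehler.ComplexTorusNefConePolyhedralSimple
import Literature.Geometry.Kaehler.ComplexTorusDivisorClassesIsogeny
import Literature.Geometry.Kaehler.ComplexTorusSubtorusIsogenyPullback
import HarnessLib

/-!
# Bauer 1998, Lemma 4.1 (Rosoff 1981): finite generation of the semigroup of effective classes
# `N(X)` is invariant under isogenies; Thm. 4.2 for a torus isogenous to a simple abelian variety

Layer `Literature/Geometry/Kaehler`, namespace `Literature.Geometry.Kaehler.ComplexTorus`; lane
`lit-hodgefound`, seat p07 (generation 44), programme «THE NEF CONE OF AN ABELIAN VARIETY», file 51 of the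
seat lineage; sequel of `ComplexTorusNefConePolyhedralSimple` (file 50: Bauer's Prop. 2.2 and Thm. 4.2 for a
simple abelian variety — `N(X)` finitely generated ⟺ `rk NS(X) = 1`), of `ComplexTorusIsogenies`
(`IsIsogeny`, the quasi-inverse `g` of an isogeny `f` of exponent `e`, `gf = e_X`, Prop. 1.1.15) and of
`ComplexTorusDivisorClassesIsogeny` / `ComplexTorusSubtorusIsogenyPullback` (`f^* NS(X') ⊆ NS(X)`,
`ρ(A)` is bijective, the Picard number is an isogeny invariant). Theorems only (no definition, no named fact, no instance, no notation; net debt `0`).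

THE SOURCE (Th. Bauer, *On the cone of curves of an abelian variety*, Amer. J. Math. 120 (1998), §4; held
arXiv alg-geom/9712019, p. 5), VERBATIM. "One needs then that finite generation of `N(X)` is a property
which is invariant under isogenies: **Lemma 4.1 ([Ros81]).** Let `X` and `Y` be isogenous abelian varieties.
Then `N(X)` is finitely generated if and only if `N(Y)` is." Proof as printed: "So suppose that `N(X)` is
finitely generated and that there is an isogeny `f : X → Y`. Thanks to the fact that `f^*` embeds `N(Y)` into
`N(X)` and to the symmetry of the situation, it is enough to show that `f^* N(Y)` is finitely generated. Let
then `N₁, …, N_k` be generators for `N(X)` and put for `1 ≤ i ≤ k`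
`nᵢ = min {n ∈ ℤ | n Nᵢ ∈ f^* N(Y)}`. (The set on the right-hand side is non-empty, since `f` is an isogeny.)
Then `f^* N(Y)` is generated by the elements `n₁N₁, …, n_rN_r` together with those elements `Σᵢ mᵢNᵢ`,
`0 ≤ mᵢ < nᵢ`, which belong to `f^* N(Y)`." And **Theorem 4.2.** "The semi-group `N(X)` is finitely generated
if and only if `NS(Xᵢ) ≅ ℤ` and `nᵢ = 1` for `1 ≤ i ≤ r`" (`X ~ X₁^{n₁} × ⋯ × X_r^{n_r}`), whose proof begins:
"By Lemma 4.1 we may assume that `X` is the product".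

THIS FILE, in the tree's vocabulary (`X = E/Φ(ℤ^ι)`, `X' = E'/Φ'(ℤ^{ι'})`, an isogeny `f = mapMatrix A`,
`IsIsogeny Φ Φ' A`, with real-linear lift `ρ(A) = realRep Φ Φ' A : E → E'`; `f^*η' = η' ∘ ρ(A)` on invariant
`2`-forms; `N(X) = {η ∈ NS(X) | H_η ≥ 0}` the semi-positive = effective = nef classes, as in file 50):
* §1 **THE MONOID LEMMA of the printed proof** (`exists_finite_addSubmonoidClosure_eq_inter`): in an additive
  commutative group, if `N₁, …, N_k` generate a submonoid `M` and `H` is a subgroup containing positive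
  multiples `nᵢNᵢ`, then `M ∩ H` is generated by the finite set `{nᵢNᵢ} ∪ {Σ mᵢNᵢ ∈ H | 0 ≤ mᵢ < nᵢ}`
  (division with remainder of the coefficients; `H` a GROUP makes the remainder `Σ mᵢNᵢ` lie in `H`). In
  Bauer's setting `M = N(X)` and `H = f^* NS(X')`, for which indeed `f^* N(X') = N(X) ∩ f^* NS(X')` (§2).
* §2 the pull-back dictionary of an isogeny on `N`: `IsIsogeny.isNSForm_comp_realRep_and_semipos` (`f^*`
  maps `N(X')` into `N(X)`), `IsIsogeny.semipos_of_semipos_comp_realRep` (and reflects semi-positivity,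
  `ρ(A)` being onto), `IsIsogeny.comp_realRep_injective` (`f^*` is injective on `2`-forms),
  `comp_realRep_comp_realRep_of_mul_eq_smul_one` (`f^* g^* = (gf)^* = [e]^* = e²` on `2`-forms for the
  quasi-inverse `g`, `BA = e·1`), hence `IsIsogeny.exists_isNSForm_comp_realRep_eq_nsmul` ("the set on the
  right-hand side is non-empty, since `f` is an isogeny": `e²·η ∈ f^* NS(X')` for every `η ∈ NS(X)`).
* §3 **LEMMA 4.1**: `IsIsogeny.exists_finset_addSubmonoidClosure_eq` (an isogeny `f : X → X'` transports
  finite generation of `N(X)` to `N(X')` — the printed direction "`f^* N(Y)` is finitely generated" followed by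
  the monoid isomorphism `f^* : N(X') ≅ f^* N(X')`), and, with the quasi-inverse isogeny `X' → X` for the
  symmetry, **`IsIsogenous.exists_finset_addSubmonoidClosure_eq_iff`** (AS PRINTED: for isogenous `X ~ X'`,
  `N(X)` is finitely generated iff `N(X')` is).
* §4 **THM. 4.2 for `r = 1`, `n₁ = 1`**: for a complex torus `X ≠ 0` isogenous to a SIMPLE abelian variety
  `X₁`, `N(X)` is finitely generated iff `rk NS(X) = 1`
  (`IsIsogenous.exists_finset_addSubmonoidClosure_eq_iff_finrank_eq_one`, from file 50's simple case and the
  isogeny invariance of the Picard number `IsIsogenous.finrank_neronSeveriGroup_eq`).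

## References

* [Bauer1998ConeOfCurves] Th. Bauer, *On the cone of curves of an abelian variety*, Amer. J. Math. 120 (1998)
  997–1006, §4 Lemma 4.1 and its proof, Thm. 4.2 (held: arXiv alg-geom/9712019, p. 5).
* [Rosoff1981] J. A. Rosoff, *The monoid of effective divisor classes of a complex torus*, in: Algebraic
  geometry (Chicago, Ill., 1980), Lecture Notes in Math. 862, Springer 1981, 208–231 (Bauer's [Ros81], the
  original of Lemma 4.1; cited through Bauer).
* [Lange2023AbelianVarietiesComplex] H. Lange, *Abelian Varieties over the Complex Numbers*, Springer 2023,
  §1.1.2 Prop. 1.1.15 (quasi-inverse of an isogeny), §2.1.1 Cor. 2.1.4 (`f^*` of a polarisation).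
-/

noncomputable section

open scoped Manifold ComplexOrder NNReal
open Complex Set Function Module Filter Topology

universe u

namespace Literature.Geometry.Kaehler

namespace ComplexTorus

/-! ### §1 The monoid lemma: `M ∩ H` is finitely generated when `H ⊇ {nᵢNᵢ}` is a subgroup -/

section Monoid

variable {M : Type*} [AddCommGroup M]

/-- **The monoid lemma of Bauer's proof of Lemma 4.1.** Let `N₁, …, N_k` (a finite family `N : κ → M` in an
additive commutative group) generate the submonoid `AddSubmonoid.closure (range N)`, and let `H` be a
SUBGROUP containing a positive multiple `nᵢNᵢ` of each generator. Then the submonoid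
`AddSubmonoid.closure (range N) ∩ H` is finitely generated — "generated by the elements `n₁N₁, …, n_kN_k` together
with those elements `Σᵢ mᵢNᵢ`, `0 ≤ mᵢ < nᵢ`, which belong to" `H` (write the coefficients `aᵢ = qᵢnᵢ + mᵢ`; the
remainder `Σ mᵢNᵢ = x - Σ qᵢ(nᵢNᵢ)` lies in the group `H`). [cite: Bauer1998ConeOfCurves, §4 Lemma 4.1 (proof)] -/
theorem exists_finite_addSubmonoidClosure_eq_inter {κ : Type*} [Fintype κ] (N : κ → M) (H : AddSubgroup M)
    (n : κ → ℕ) (hn : ∀ i, 0 < n i) (hnH : ∀ i, n i • N i ∈ H) :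
    ∃ G : Set M, G.Finite ∧
      (AddSubmonoid.closure G : Set M) = (AddSubmonoid.closure (Set.range N) : Set M) ∩ (H : Set M) := by
  classical
  -- the generators: `nᵢ Nᵢ` and the small combinations `Σ mᵢ Nᵢ`, `mᵢ < nᵢ`, lying in `H`
  set G₁ : Set M := Set.range fun i ↦ n i • N i with hG₁
  set G₂ : Set M := {x | x ∈ Set.range (fun m : (∀ i, Fin (n i)) ↦ ∑ i, ((m i : ℕ)) • N i) ∧ x ∈ H} with hG₂
  refine ⟨G₁ ∪ G₂, (Set.finite_range _).union ((Set.finite_range _).subset fun x hx ↦ hx.1), ?_⟩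
  refine Set.Subset.antisymm ?_ ?_
  · -- `closure G ⊆ closure (range N) ∩ H`
    have hle : AddSubmonoid.closure (G₁ ∪ G₂) ≤ AddSubmonoid.closure (Set.range N) ⊓ H.toAddSubmonoid := by
      refine AddSubmonoid.closure_le.2 fun x hx ↦ ?_
      rcases hx with ⟨i, rfl⟩ | ⟨⟨m, rfl⟩, hxH⟩
      · exact AddSubmonoid.mem_inf.2
          ⟨AddSubmonoid.nsmul_mem _ (AddSubmonoid.subset_closure (Set.mem_range_self i)) _, hnH i⟩
      · exact AddSubmonoid.mem_inf.2 ⟨AddSubmonoid.sum_mem _ fun i _ ↦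
          AddSubmonoid.nsmul_mem _ (AddSubmonoid.subset_closure (Set.mem_range_self i)) _, hxH⟩
    intro x hx
    have hx' := AddSubmonoid.mem_inf.1 (hle hx)
    exact ⟨hx'.1, hx'.2⟩
  · rintro x ⟨hxM, hxH⟩
    obtain ⟨a, rfl⟩ := AddSubmonoid.mem_closure_range_iff_of_fintype.1 hxM
    -- division with remainder of the coefficients
    have hsplit : (∑ i, a i • N i) = (∑ i, (a i / n i) • (n i • N i)) + (∑ i, (a i % n i) • N i) := by
      rw [← Finset.sum_add_distrib]
      refine Finset.sum_congr rfl fun i _ ↦ ?_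
      rw [← mul_smul, ← add_smul, Nat.div_add_mod']
    have hqH : (∑ i, (a i / n i) • (n i • N i)) ∈ H := H.sum_mem fun i _ ↦ H.nsmul_mem (hnH i) _
    have hrH : (∑ i, (a i % n i) • N i) ∈ H := by
      have h := H.sub_mem hxH hqH
      rwa [hsplit, add_sub_cancel_left] at h
    have hrG : (∑ i, (a i % n i) • N i) ∈ G₁ ∪ G₂ := by
      refine Set.mem_union_right _ ?_
      simp only [hG₂, Set.mem_setOf_eq, Set.mem_range]
      exact ⟨⟨fun i ↦ ⟨a i % n i, Nat.mod_lt _ (hn i)⟩, rfl⟩, hrH⟩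
    have hmem : ((∑ i, (a i / n i) • (n i • N i)) + (∑ i, (a i % n i) • N i)) ∈
        AddSubmonoid.closure (G₁ ∪ G₂) :=
      AddSubmonoid.add_mem _
        (AddSubmonoid.sum_mem _ fun i _ ↦
          AddSubmonoid.nsmul_mem _ (AddSubmonoid.subset_closure (Set.mem_union_left _ (Set.mem_range_self i))) _)
        (AddSubmonoid.subset_closure hrG)
    rw [hsplit]
    exact hmem

/-- **Finite generation passes to `M ∩ H`** (the monoid lemma with a `Finset` of generators): if a finite
`S` generates `AddSubmonoid.closure S` and the subgroup `H` contains a positive multiple of every `s ∈ S`, then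
`AddSubmonoid.closure S ∩ H = AddSubmonoid.closure S'` for a finite `S'`. [cite: Bauer1998ConeOfCurves, §4 Lemma 4.1 (proof)] -/
theorem exists_finset_addSubmonoidClosure_eq_inter (S : Finset M) (H : AddSubgroup M)
    (hnH : ∀ s ∈ S, ∃ n : ℕ, 0 < n ∧ n • s ∈ H) :
    ∃ S' : Finset M,
      (AddSubmonoid.closure (S' : Set M) : Set M) = (AddSubmonoid.closure (S : Set M) : Set M) ∩ (H : Set M) := by
  classical
  have hch : ∀ s : (S : Set M), ∃ n : ℕ, 0 < n ∧ n • (s : M) ∈ H := fun s ↦ hnH s s.2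
  choose n hn hnH' using hch
  obtain ⟨G, hGfin, hG⟩ := exists_finite_addSubmonoidClosure_eq_inter (fun s : (S : Set M) ↦ (s : M)) H n hn hnH'
  refine ⟨hGfin.toFinset, ?_⟩
  rw [Set.Finite.coe_toFinset, hG, Subtype.range_coe]

end Monoid

/-! ### §2 Pull-back of `N(X')` along an isogeny `f : X → X'`: into `N(X)`, injective, `f^* g^* = e²` -/

section Pullback

variable {ι ι' : Type*} [Fintype ι] [Fintype ι'] [DecidableEq ι] [DecidableEq ι']
  {E E' : Type*} [NormedAddCommGroup E] [NormedSpace ℂ E] [NormedAddCommGroup E'] [NormedSpace ℂ E']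
  (Φ : (ι → ℝ) ≃L[ℝ] E) (Φ' : (ι' → ℝ) ≃L[ℝ] E') {A : Matrix ι' ι ℤ}

omit [Fintype ι'] [DecidableEq ι] [DecidableEq ι'] in
/-- The pulled-back hermitian form: `(f^*η')(iv, v) = η'(iρv, ρv)` for an isogeny (`ρ(A)` is `ℂ`-linear).
[cite: Lange2023AbelianVarietiesComplex, §2.1.1 Cor. 2.1.4] -/
theorem IsIsogeny.comp_realRep_apply_I_smul_self (h : IsIsogeny Φ Φ' A) (η' : E' [⋀^Fin 2]→L[ℝ] ℝ) (v : E) :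
    (η'.compContinuousLinearMap (realRep Φ Φ' A)) ![I • v, v] =
      η' ![I • realRep Φ Φ' A v, realRep Φ Φ' A v] := by
  rw [ContinuousAlternatingMap.compContinuousLinearMap_apply]
  congr 1
  funext i
  fin_cases i
  · exact h.realRep_smul Φ Φ' I v
  · rfl

omit [Fintype ι'] [DecidableEq ι] [DecidableEq ι'] in
/-- **`f^* N(X') ⊆ N(X)`**: the pull-back `η' ∘ ρ(A)` of a semi-positive class `η' ∈ NS(X')` along an isogeny
(indeed along any holomorphic homomorphism) is a semi-positive class of `NS(X)` ("`f^*` embeds `N(Y)` into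
`N(X)`"). [cite: Bauer1998ConeOfCurves, §4 Lemma 4.1 (proof)] [cite: Lange2023AbelianVarietiesComplex, §2.1.1 Cor. 2.1.4] -/
theorem IsIsogeny.isNSForm_comp_realRep_and_semipos (h : IsIsogeny Φ Φ' A) {η' : E' [⋀^Fin 2]→L[ℝ] ℝ}
    (hη' : IsNSForm Φ' η' ∧ ∀ w : E', 0 ≤ η' ![I • w, w]) :
    IsNSForm Φ (η'.compContinuousLinearMap (realRep Φ Φ' A)) ∧
      ∀ v : E, 0 ≤ (η'.compContinuousLinearMap (realRep Φ Φ' A)) ![I • v, v] := by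
  refine ⟨hη'.1.comp_realRep Φ Φ' A (h.realRep_smul Φ Φ'), fun v ↦ ?_⟩
  rw [h.comp_realRep_apply_I_smul_self Φ Φ']
  exact hη'.2 _

omit [DecidableEq ι] [DecidableEq ι'] in
/-- **`f^*` reflects semi-positivity**: for an isogeny, `ρ(A) : E → E'` is onto, so `η'` is positive
semi-definite as soon as `f^*η' = η' ∘ ρ(A)` is (`f^* N(X') = N(X) ∩ f^* NS(X')`). [cite: Bauer1998ConeOfCurves, §4 Lemma 4.1 (proof)] -/
theorem IsIsogeny.semipos_of_semipos_comp_realRep (h : IsIsogeny Φ Φ' A) {η' : E' [⋀^Fin 2]→L[ℝ] ℝ}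
    (hpsd : ∀ v : E, 0 ≤ (η'.compContinuousLinearMap (realRep Φ Φ' A)) ![I • v, v]) (w : E') :
    0 ≤ η' ![I • w, w] := by
  obtain ⟨v, rfl⟩ := (h.bijective_realRep Φ Φ').2 w
  rw [← h.comp_realRep_apply_I_smul_self Φ Φ']
  exact hpsd v

omit [DecidableEq ι] [DecidableEq ι'] in
/-- **`f^*` is injective on `2`-forms** for an isogeny (`ρ(A)` is onto). [cite: Lange2023AbelianVarietiesComplex, §1.1.2 Lemma 1.1.11] -/
theorem IsIsogeny.comp_realRep_injective (h : IsIsogeny Φ Φ' A) :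
    Function.Injective fun η' : E' [⋀^Fin 2]→L[ℝ] ℝ ↦ η'.compContinuousLinearMap (realRep Φ Φ' A) := by
  intro η₁ η₂ h12
  ext w
  have hw : ∀ i, ∃ v, realRep Φ Φ' A v = w i := fun i ↦ (h.bijective_realRep Φ Φ').2 (w i)
  choose v hv using hw
  have hvw : (⇑(realRep Φ Φ' A) ∘ v) = w := funext hv
  have h := congrArg (fun θ : E [⋀^Fin 2]→L[ℝ] ℝ ↦ θ v) h12
  simp only [ContinuousAlternatingMap.compContinuousLinearMap_apply, hvw] at h
  exact h

omit [DecidableEq ι'] in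
/-- **`f^* g^* = [e]^* = e²` on `2`-forms**: if `B A = e · 1` (the quasi-inverse relation of Prop. 1.1.15),
then `(η ∘ ρ(B)) ∘ ρ(A) = η ∘ ρ(BA) = η ∘ (e · id) = e² η`. [cite: Lange2023AbelianVarietiesComplex, §1.1.2 Prop. 1.1.15]
[cite: Bauer1998ConeOfCurves, §4 Lemma 4.1 (proof: "since `f` is an isogeny")] -/
theorem comp_realRep_comp_realRep_of_mul_eq_smul_one {B : Matrix ι ι' ℤ} {e : ℤ}
    (hBA : B * A = e • (1 : Matrix ι ι ℤ)) (η : E [⋀^Fin 2]→L[ℝ] ℝ) :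
    (η.compContinuousLinearMap (realRep Φ' Φ B)).compContinuousLinearMap (realRep Φ Φ' A) = ((e : ℝ) ^ 2) • η := by
  have hcomp : (η.compContinuousLinearMap (realRep Φ' Φ B)).compContinuousLinearMap (realRep Φ Φ' A) =
      η.compContinuousLinearMap ((realRep Φ' Φ B).comp (realRep Φ Φ' A)) := by
    ext v
    rfl
  rw [hcomp, realRep_mul, hBA, realRep_smul_one]
  ext v
  rw [ContinuousAlternatingMap.compContinuousLinearMap_apply, ContinuousAlternatingMap.smul_apply]
  have h := η.map_smul_univ (fun _ : Fin 2 ↦ (e : ℝ)) v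
  simp only [Finset.prod_const, Finset.card_univ, Fintype.card_fin] at h
  rw [← h]
  rfl

/-- **"The set `{n ∈ ℤ | nNᵢ ∈ f^* N(Y)}` is non-empty, since `f` is an isogeny"**: for an isogeny `f` of
exponent `e` with quasi-inverse `g` (`gf = e_X`), every `η ∈ NS(X)` has `e² η = f^*(g^* η)` with
`g^* η ∈ NS(X')`, and `g^* η` is semi-positive when `η` is. [cite: Bauer1998ConeOfCurves, §4 Lemma 4.1 (proof)]
[cite: Lange2023AbelianVarietiesComplex, §1.1.2 Prop. 1.1.15] -/
theorem IsIsogeny.exists_isNSForm_comp_realRep_eq_nsmul (h : IsIsogeny Φ Φ' A) :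
    ∃ n : ℕ, 0 < n ∧ ∀ η : E [⋀^Fin 2]→L[ℝ] ℝ, IsNSForm Φ η →
      ∃ η' : E' [⋀^Fin 2]→L[ℝ] ℝ, IsNSForm Φ' η' ∧
        ((∀ v : E, 0 ≤ η ![I • v, v]) → ∀ w : E', 0 ≤ η' ![I • w, w]) ∧
        η'.compContinuousLinearMap (realRep Φ Φ' A) = n • η := by
  obtain ⟨B, hB, hBA, -⟩ := h.exists_quasiInverse
  refine ⟨(AddMonoid.exponent (mapMatrixHom Φ Φ' A).ker) ^ 2, pow_pos h.exponent_ker_pos 2, fun η hη ↦ ?_⟩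
  refine ⟨η.compContinuousLinearMap (realRep Φ' Φ B), hη.comp_realRep Φ' Φ B (hB.realRep_smul Φ' Φ),
    fun hpsd ↦ (hB.isNSForm_comp_realRep_and_semipos Φ' Φ ⟨hη, hpsd⟩).2, ?_⟩
  rw [comp_realRep_comp_realRep_of_mul_eq_smul_one Φ Φ' hBA η, ← Nat.cast_smul_eq_nsmul ℝ, Nat.cast_pow,
    Int.cast_natCast]

end Pullback

/-! ### §3 Lemma 4.1: finite generation of `N(X)` is an isogeny invariant -/

section LemmaFourOne

variable {ι ι' : Type*} [Fintype ι] [Fintype ι'] [DecidableEq ι] [DecidableEq ι']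
  {E E' : Type*} [NormedAddCommGroup E] [NormedSpace ℂ E] [NormedAddCommGroup E'] [NormedSpace ℂ E']
  (Φ : (ι → ℝ) ≃L[ℝ] E) (Φ' : (ι' → ℝ) ≃L[ℝ] E') {A : Matrix ι' ι ℤ}

/-- **Bauer 1998, Lemma 4.1, the printed direction along an isogeny `f : X → X'`: if `N(X)` is finitely
generated, so is `N(X')`.** Proof as printed: `H = f^* NS(X')` is a subgroup of the `2`-forms on `E` containing
`e²N(X)` (§2), so `N(X) ∩ H` is finitely generated by the monoid lemma (§1); `N(X) ∩ H = f^* N(X')` (pull-backs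
of classes of `NS(X')` that are semi-positive are pull-backs of semi-positive classes, §2), and `f^*` is an
injective monoid homomorphism, so `N(X')` is generated by the (unique) preimages of the finitely many
generators of `f^* N(X')`. [cite: Bauer1998ConeOfCurves, §4 Lemma 4.1] -/
theorem IsIsogeny.exists_finset_addSubmonoidClosure_eq (h : IsIsogeny Φ Φ' A) {S : Finset (E [⋀^Fin 2]→L[ℝ] ℝ)}
    (hS : (AddSubmonoid.closure (S : Set (E [⋀^Fin 2]→L[ℝ] ℝ)) : Set (E [⋀^Fin 2]→L[ℝ] ℝ)) =
      {η | IsNSForm Φ η ∧ ∀ v : E, 0 ≤ η ![I • v, v]}) :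
    ∃ S' : Finset (E' [⋀^Fin 2]→L[ℝ] ℝ),
      (AddSubmonoid.closure (S' : Set (E' [⋀^Fin 2]→L[ℝ] ℝ)) : Set (E' [⋀^Fin 2]→L[ℝ] ℝ)) =
        {η' | IsNSForm Φ' η' ∧ ∀ w : E', 0 ≤ η' ![I • w, w]} := by
  classical
  -- the pull-back `f^*` as an additive (indeed linear) map, and `H = f^* NS(X')`
  set pb : (E' [⋀^Fin 2]→L[ℝ] ℝ) →ₗ[ℝ] (E [⋀^Fin 2]→L[ℝ] ℝ) :=
    ContinuousAlternatingMap.compContinuousLinearMapₗ (realRep Φ Φ' A) with hpb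
  have hpb_apply : ∀ η' : E' [⋀^Fin 2]→L[ℝ] ℝ, pb η' = η'.compContinuousLinearMap (realRep Φ Φ' A) :=
    fun η' ↦ rfl
  set H : AddSubgroup (E [⋀^Fin 2]→L[ℝ] ℝ) := (neronSeveriGroup Φ').map pb.toAddMonoidHom with hH
  have hmemH : ∀ θ : E [⋀^Fin 2]→L[ℝ] ℝ, θ ∈ H ↔ ∃ η' : E' [⋀^Fin 2]→L[ℝ] ℝ, IsNSForm Φ' η' ∧
      η'.compContinuousLinearMap (realRep Φ Φ' A) = θ := fun θ ↦ by
    rw [hH, AddSubgroup.mem_map]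
    exact ⟨fun ⟨η', hη', hθ⟩ ↦ ⟨η', (mem_neronSeveriGroup_iff Φ').1 hη', hθ⟩,
      fun ⟨η', hη', hθ⟩ ↦ ⟨η', (mem_neronSeveriGroup_iff Φ').2 hη', hθ⟩⟩
  -- every generator has a positive multiple in `H`
  obtain ⟨n, hn, hnH⟩ := h.exists_isNSForm_comp_realRep_eq_nsmul Φ Φ'
  have hSN : ∀ s ∈ S, IsNSForm Φ s ∧ ∀ v : E, 0 ≤ s ![I • v, v] := fun s hs ↦ by
    have hs' : s ∈ (AddSubmonoid.closure (S : Set (E [⋀^Fin 2]→L[ℝ] ℝ)) : Set (E [⋀^Fin 2]→L[ℝ] ℝ)) :=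
      AddSubmonoid.subset_closure hs
    rw [hS] at hs'
    exact hs'
  have hmult : ∀ s ∈ S, ∃ m : ℕ, 0 < m ∧ m • s ∈ H := fun s hs ↦ by
    obtain ⟨η', hη', -, hη's⟩ := hnH s (hSN s hs).1
    exact ⟨n, hn, (hmemH _).2 ⟨η', hη', hη's⟩⟩
  -- the monoid lemma: `N(X) ∩ H` is finitely generated
  obtain ⟨S₁, hS₁⟩ := exists_finset_addSubmonoidClosure_eq_inter S H hmult
  -- generators of `N(X) ∩ H` are pull-backs of semi-positive classes of `NS(X')`
  have hgen₁ : ∀ θ ∈ S₁, ∃ η' : E' [⋀^Fin 2]→L[ℝ] ℝ, (IsNSForm Φ' η' ∧ ∀ w : E', 0 ≤ η' ![I • w, w]) ∧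
      η'.compContinuousLinearMap (realRep Φ Φ' A) = θ := fun θ hθ ↦ by
    have hθ' : θ ∈ (AddSubmonoid.closure (S₁ : Set (E [⋀^Fin 2]→L[ℝ] ℝ)) : Set (E [⋀^Fin 2]→L[ℝ] ℝ)) :=
      AddSubmonoid.subset_closure hθ
    rw [hS₁, hS] at hθ'
    obtain ⟨⟨-, hθpsd⟩, hθH⟩ := hθ'
    obtain ⟨η', hη', rfl⟩ := (hmemH θ).1 hθH
    exact ⟨η', ⟨hη', h.semipos_of_semipos_comp_realRep Φ Φ' hθpsd⟩, rfl⟩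
  choose! pre hpre hpre_eq using hgen₁
  refine ⟨S₁.image pre, Set.Subset.antisymm ?_ ?_⟩
  · -- the chosen preimages generate a submonoid of `N(X')`
    have hle : AddSubmonoid.closure ((S₁.image pre : Finset _) : Set (E' [⋀^Fin 2]→L[ℝ] ℝ)) ≤
        ((neronSeveriGroup Φ').toAddSubmonoid ⊓
          { carrier := {η' | ∀ w : E', 0 ≤ η' ![I • w, w]}
            add_mem' := fun {a b} ha hb w ↦ by
              rw [ContinuousAlternatingMap.add_apply]
              exact add_nonneg (ha w) (hb w)
            zero_mem' := fun w ↦ by rw [ContinuousAlternatingMap.coe_zero, Pi.zero_apply] }) := by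
      refine AddSubmonoid.closure_le.2 fun η' hη' ↦ ?_
      rw [Finset.coe_image] at hη'
      obtain ⟨θ, hθ, rfl⟩ := hη'
      exact ⟨(hpre θ hθ).1, (hpre θ hθ).2⟩
    intro η' hη'
    have h' := hle hη'
    exact ⟨h'.1, h'.2⟩
  · -- every semi-positive class of `NS(X')` is a combination of the preimages: pull back and use injectivity
    rintro η' ⟨hη', hpsd'⟩
    have hθ : η'.compContinuousLinearMap (realRep Φ Φ' A) ∈
        (AddSubmonoid.closure (S₁ : Set (E [⋀^Fin 2]→L[ℝ] ℝ)) : Set (E [⋀^Fin 2]→L[ℝ] ℝ)) := by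
      rw [hS₁, hS]
      exact ⟨h.isNSForm_comp_realRep_and_semipos Φ Φ' ⟨hη', hpsd'⟩, (hmemH _).2 ⟨η', hη', rfl⟩⟩
    obtain ⟨a, ha⟩ := AddSubmonoid.mem_closure_finset'.1 hθ
    -- `f^* η' = Σ a_θ θ = f^* (Σ a_θ pre θ)`
    have hsum : η'.compContinuousLinearMap (realRep Φ Φ' A) =
        (∑ θ : (S₁ : Set (E [⋀^Fin 2]→L[ℝ] ℝ)), a θ • pre θ).compContinuousLinearMap (realRep Φ Φ' A) := by
      rw [ha, ← hpb_apply, map_sum]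
      refine Finset.sum_congr rfl fun θ _ ↦ ?_
      rw [map_nsmul, hpb_apply, hpre_eq θ θ.2]
    have hinj := h.comp_realRep_injective Φ Φ' hsum
    rw [hinj]
    exact AddSubmonoid.sum_mem _ fun θ _ ↦ AddSubmonoid.nsmul_mem _
      (AddSubmonoid.subset_closure (Finset.mem_coe.2 (Finset.mem_image_of_mem pre θ.2))) _

/-- **Bauer 1998, Lemma 4.1 ([Ros81]), AS PRINTED: "Let `X` and `Y` be isogenous abelian varieties. Then
`N(X)` is finitely generated if and only if `N(Y)` is."** (For any isogenous complex tori; `N` = the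
semigroup of semi-positive = effective classes; the converse direction is the printed one applied to the
quasi-inverse isogeny `Y → X` — "the symmetry of the situation".) [cite: Bauer1998ConeOfCurves, §4 Lemma 4.1] -/
theorem IsIsogenous.exists_finset_addSubmonoidClosure_eq_iff (h : IsIsogenous Φ Φ') :
    (∃ S : Finset (E [⋀^Fin 2]→L[ℝ] ℝ),
        (AddSubmonoid.closure (S : Set (E [⋀^Fin 2]→L[ℝ] ℝ)) : Set (E [⋀^Fin 2]→L[ℝ] ℝ)) =
          {η | IsNSForm Φ η ∧ ∀ v : E, 0 ≤ η ![I • v, v]}) ↔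
      ∃ S' : Finset (E' [⋀^Fin 2]→L[ℝ] ℝ),
        (AddSubmonoid.closure (S' : Set (E' [⋀^Fin 2]→L[ℝ] ℝ)) : Set (E' [⋀^Fin 2]→L[ℝ] ℝ)) =
          {η' | IsNSForm Φ' η' ∧ ∀ w : E', 0 ≤ η' ![I • w, w]} := by
  obtain ⟨A, hA⟩ := h
  obtain ⟨B, hB, -, -⟩ := hA.exists_quasiInverse
  exact ⟨fun ⟨S, hS⟩ ↦ hA.exists_finset_addSubmonoidClosure_eq Φ Φ' hS,
    fun ⟨S', hS'⟩ ↦ hB.exists_finset_addSubmonoidClosure_eq Φ' Φ hS'⟩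

end LemmaFourOne

/-! ### §4 Thm. 4.2 for `r = 1`, `n₁ = 1`: a torus isogenous to a simple abelian variety -/

section ThmFourTwo

variable {ι ι' : Type*} [Fintype ι] [Fintype ι'] [DecidableEq ι] [DecidableEq ι']
  {E E' : Type*} [NormedAddCommGroup E] [NormedSpace ℂ E] [NormedAddCommGroup E'] [NormedSpace ℂ E']
  (Φ : (ι → ℝ) ≃L[ℝ] E) (Φ' : (ι' → ℝ) ≃L[ℝ] E')

/-- **Bauer 1998, Thm. 4.2 with `r = 1`, `n₁ = 1`: for a complex torus `X` isogenous to a SIMPLE abelian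
variety `X₁ ≠ 0`, the semigroup `N(X)` of effective (= semi-positive) classes is finitely generated if and only
if `NS(X) ≅ ℤ` (`rk NS(X) = 1`).** "By Lemma 4.1 we may assume that `X` is the product" `X₁`: finite
generation is an isogeny invariant (§3), on the simple `X₁` it is equivalent to `rk NS(X₁) = 1` (file 50,
`IsSimple.exists_addSubmonoidClosure_eq_iff_finrank_eq_one`), and the Picard number is an isogeny invariant
(`IsIsogenous.finrank_neronSeveriGroup_eq`). [cite: Bauer1998ConeOfCurves, §4 Thm. 4.2 and Lemma 4.1] -/
theorem IsIsogenous.exists_finset_addSubmonoidClosure_eq_iff_finrank_eq_one [Nontrivial E']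
    (h : IsIsogenous Φ Φ') (hS : IsSimple Φ') (hX' : IsAbelianVariety Φ') :
    (∃ S : Finset (E [⋀^Fin 2]→L[ℝ] ℝ),
        (AddSubmonoid.closure (S : Set (E [⋀^Fin 2]→L[ℝ] ℝ)) : Set (E [⋀^Fin 2]→L[ℝ] ℝ)) =
          {η | IsNSForm Φ η ∧ ∀ v : E, 0 ≤ η ![I • v, v]}) ↔
      finrank ℤ (neronSeveriGroup Φ) = 1 := by
  rw [h.exists_finset_addSubmonoidClosure_eq_iff Φ Φ', hS.exists_addSubmonoidClosure_eq_iff_finrank_eq_one Φ' hX',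
    h.finrank_neronSeveriGroup_eq]

end ThmFourTwo

end ComplexTorus

end Literature.Geometry.Kaehler

end
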